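import Summits.Ventures.PercRepro.ProfilePointedCircuitClassesTwelveCaptureB
import Summits.Ventures.PercRepro.ProfilePointedCircuitClassesFiveSeriesMem

/-!
# PercRepro — THE TWELVE-POINT STATEMENT ON EVERY NON-COSIMPLE MATROID, MODULO THE CAPTURE INEQUALITY
(p5, gen 45; `proofs/P5-GM1.md` §67(e))

`CaptureIneq α` (a `Prop`; a CONJECTURE, NOT asserted): for every `12`-point matroid of rank `7`, every series pair
`{a, a'}` and every point `e ∉ {a, a'}`, the demands through `a` whose closure contains `a'` are at most the units
through `a` whose closure contains `a'` — the capture inequality (C) of TwelveCaptureB.  With it, every point of a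
matroid that HAS a series pair is settled: a point inside a series pair by `inCount_five_le_outCount_six_of_seriesPair_mem`
(FiveSeriesMem, unconditional), a point avoided by the pair by the capture reduction.  So `InOutBottomTwelve` holds on
every non-cosimple `12`-point matroid of rank `7` as soon as (C) does (`inCount_five_le_outCount_six_of_seriesPair_of_captureIneq`).
-/

open scoped Matroid

namespace PercRepro.Cogirth

open Finset ThmH Skew Shadow Profile

variable {α : Type} [DecidableEq α] {N : Matroid α} [N.Finite]

section TwelveCaptureC

/-- **THE CAPTURE INEQUALITY** (a `Prop`; a CONJECTURE, NOT asserted; §67(c)): on every `12`-point matroid of rank `7`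
with a series pair `{a, a'}`, at every point `e ∉ {a, a'}`,
`#{W ∈ BI_5 : e ∈ W, a ∈ W, ρ(W + a') = 5} ≤ #{S ∈ BI_6 : e ∉ S, a ∈ S, ρ(S + a') = 6}` — the in–out inequality of
the demands / units through `a` whose closure contains the cocircuit `{a, a'}`.  It is strictly weaker than the
refuted eleven-point inequality `StarEleven` (§66 ADD 3) and census-true where that fails (0 failures on ≈ 92,000
random ordered pairs and the pencil family; §67(f)). -/
def CaptureIneq (α : Type) [DecidableEq α] : Prop :=
  ∀ (N : Matroid α) [N.Finite] (a a' e : α), SeriesPair N a a' → (gr N).card = 12 → rk N (gr N) = 7 →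
    e ∈ gr N → e ≠ a → e ≠ a' →
    ((biIndepSets N 5).filter (fun W => (e ∈ W ∧ a ∈ W) ∧ rk N (insert a' W) = 5)).card ≤
      ((biIndepSets N 6).filter (fun S => (e ∉ S ∧ a ∈ S) ∧ rk N (insert a' S) = 6)).card

/-- **THE TWELVE-POINT STATEMENT AT EVERY POINT OF A MATROID WITH A SERIES PAIR, MODULO (C)**: on `#E = 12`,
`ρ(E) = 7`, if `{a, a'}` is a series pair then `in_5(e) ≤ out_6(e)` at every point `e` — inside the pair
unconditionally (`inCount_five_le_outCount_six_of_twelve_of_seriesPair_mem`), outside it by the capture reduction. -/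
theorem inCount_five_le_outCount_six_of_seriesPair_of_captureIneq (hC : CaptureIneq α) (hn : (gr N).card = 12)
    (hR : rk N (gr N) = 7) {a a' : α} (h : SeriesPair N a a') {e : α} (he : e ∈ gr N) :
    inCount N 5 e ≤ outCount N 6 e := by
  by_cases hea : e = a
  · subst hea
    exact inCount_five_le_outCount_six_of_twelve_of_seriesPair_mem hn hR h
  by_cases hea' : e = a'
  · subst hea'
    exact inCount_five_le_outCount_six_of_twelve_of_seriesPair_mem hn hR h.symm
  exact inCount_five_le_outCount_six_of_seriesPair_of_capture hn hR h he hea hea'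
    (hC N a a' e h hn hR he hea hea')

/-- **`InOutBottomTwelve` ON EVERY NON-COSIMPLE MATROID, MODULO (C)**: for every `12`-point matroid of rank `7` that
has a series pair, `in_5(e) ≤ out_6(e)` at every point. -/
theorem inOutBottomTwelve_of_exists_seriesPair_of_captureIneq (hC : CaptureIneq α) (hn : (gr N).card = 12)
    (hR : rk N (gr N) = 7) (hser : ∃ a a', SeriesPair N a a') : ∀ e ∈ gr N, inCount N 5 e ≤ outCount N 6 e := by
  obtain ⟨a, a', h⟩ := hser
  intro e he
  exact inCount_five_le_outCount_six_of_seriesPair_of_captureIneq hC hn hR h he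

end TwelveCaptureC

end PercRepro.Cogirth
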